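import Literature.NumberTheory.LFunctions.FordLargeLambdaTailCheck
import HarnessLib

/-!
# Kernel evaluation of the tail box certificate, `u`-row `i = 1`

Topic `Literature/NumberTheory/LFunctions`. Kernel computations (`decide +kernel`) only: for `i = 1`
and each `j < 16`, the cells `(i, j, l)`, `l < 50`, of the box certificate `FordVK.Tail.checkCell`
(`FordLargeLambdaTailCheck.lean`) pass; `urow_1` collects the row. One theorem per `(i, j)` keeps
each kernel evaluation small. No definitions, no facts.

## References
* K. Ford, Proc. London Math. Soc. (3) 85 (2002), 565–633: §5, Lemma 5.2. [Ford2002]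
-/

namespace Literature.NumberTheory.LFunctions
namespace FordVK
namespace Tail

set_option maxHeartbeats 0 in
/-- The cells `(1, 0, l)`, `l < 50`, pass (kernel evaluation). [cite: Ford2002, Lemma 5.2 (numerical verification)] -/
theorem cell_1_0 : ((List.range 50).all fun l => checkCell 1 0 l) = true := by
  decide +kernel

set_option maxHeartbeats 0 in
/-- The cells `(1, 1, l)`, `l < 50`, pass (kernel evaluation). [cite: Ford2002, Lemma 5.2 (numerical verification)] -/
theorem cell_1_1 : ((List.range 50).all fun l => checkCell 1 1 l) = true := by
  decide +kernel

set_option maxHeartbeats 0 in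
/-- The cells `(1, 2, l)`, `l < 50`, pass (kernel evaluation). [cite: Ford2002, Lemma 5.2 (numerical verification)] -/
theorem cell_1_2 : ((List.range 50).all fun l => checkCell 1 2 l) = true := by
  decide +kernel

set_option maxHeartbeats 0 in
/-- The cells `(1, 3, l)`, `l < 50`, pass (kernel evaluation). [cite: Ford2002, Lemma 5.2 (numerical verification)] -/
theorem cell_1_3 : ((List.range 50).all fun l => checkCell 1 3 l) = true := by
  decide +kernel

set_option maxHeartbeats 0 in
/-- The cells `(1, 4, l)`, `l < 50`, pass (kernel evaluation). [cite: Ford2002, Lemma 5.2 (numerical verification)] -/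
theorem cell_1_4 : ((List.range 50).all fun l => checkCell 1 4 l) = true := by
  decide +kernel

set_option maxHeartbeats 0 in
/-- The cells `(1, 5, l)`, `l < 50`, pass (kernel evaluation). [cite: Ford2002, Lemma 5.2 (numerical verification)] -/
theorem cell_1_5 : ((List.range 50).all fun l => checkCell 1 5 l) = true := by
  decide +kernel

set_option maxHeartbeats 0 in
/-- The cells `(1, 6, l)`, `l < 50`, pass (kernel evaluation). [cite: Ford2002, Lemma 5.2 (numerical verification)] -/
theorem cell_1_6 : ((List.range 50).all fun l => checkCell 1 6 l) = true := by
  decide +kernel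

set_option maxHeartbeats 0 in
/-- The cells `(1, 7, l)`, `l < 50`, pass (kernel evaluation). [cite: Ford2002, Lemma 5.2 (numerical verification)] -/
theorem cell_1_7 : ((List.range 50).all fun l => checkCell 1 7 l) = true := by
  decide +kernel

set_option maxHeartbeats 0 in
/-- The cells `(1, 8, l)`, `l < 50`, pass (kernel evaluation). [cite: Ford2002, Lemma 5.2 (numerical verification)] -/
theorem cell_1_8 : ((List.range 50).all fun l => checkCell 1 8 l) = true := by
  decide +kernel

set_option maxHeartbeats 0 in
/-- The cells `(1, 9, l)`, `l < 50`, pass (kernel evaluation). [cite: Ford2002, Lemma 5.2 (numerical verification)] -/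
theorem cell_1_9 : ((List.range 50).all fun l => checkCell 1 9 l) = true := by
  decide +kernel

set_option maxHeartbeats 0 in
/-- The cells `(1, 10, l)`, `l < 50`, pass (kernel evaluation). [cite: Ford2002, Lemma 5.2 (numerical verification)] -/
theorem cell_1_10 : ((List.range 50).all fun l => checkCell 1 10 l) = true := by
  decide +kernel

set_option maxHeartbeats 0 in
/-- The cells `(1, 11, l)`, `l < 50`, pass (kernel evaluation). [cite: Ford2002, Lemma 5.2 (numerical verification)] -/
theorem cell_1_11 : ((List.range 50).all fun l => checkCell 1 11 l) = true := by
  decide +kernel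

set_option maxHeartbeats 0 in
/-- The cells `(1, 12, l)`, `l < 50`, pass (kernel evaluation). [cite: Ford2002, Lemma 5.2 (numerical verification)] -/
theorem cell_1_12 : ((List.range 50).all fun l => checkCell 1 12 l) = true := by
  decide +kernel

set_option maxHeartbeats 0 in
/-- The cells `(1, 13, l)`, `l < 50`, pass (kernel evaluation). [cite: Ford2002, Lemma 5.2 (numerical verification)] -/
theorem cell_1_13 : ((List.range 50).all fun l => checkCell 1 13 l) = true := by
  decide +kernel

set_option maxHeartbeats 0 in
/-- The cells `(1, 14, l)`, `l < 50`, pass (kernel evaluation). [cite: Ford2002, Lemma 5.2 (numerical verification)] -/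
theorem cell_1_14 : ((List.range 50).all fun l => checkCell 1 14 l) = true := by
  decide +kernel

set_option maxHeartbeats 0 in
/-- The cells `(1, 15, l)`, `l < 50`, pass (kernel evaluation). [cite: Ford2002, Lemma 5.2 (numerical verification)] -/
theorem cell_1_15 : ((List.range 50).all fun l => checkCell 1 15 l) = true := by
  decide +kernel

/-- The `u`-row `i = 1` of the box certificate passes. [cite: Ford2002, Lemma 5.2 (numerical verification)] -/
theorem urow_1 : ((List.range nD).all fun j => (List.range 50).all fun l => checkCell 1 j l) = true := by
  unfold nD
  rw [List.all_eq_true]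
  intro j hj
  rw [List.mem_range] at hj
  interval_cases j
  · exact cell_1_0
  · exact cell_1_1
  · exact cell_1_2
  · exact cell_1_3
  · exact cell_1_4
  · exact cell_1_5
  · exact cell_1_6
  · exact cell_1_7
  · exact cell_1_8
  · exact cell_1_9
  · exact cell_1_10
  · exact cell_1_11
  · exact cell_1_12
  · exact cell_1_13
  · exact cell_1_14
  · exact cell_1_15

end Tail
end FordVK
end Literature.NumberTheory.LFunctions
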